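import Summits.Ventures.PercRepro.S1NineSixSevenElevenComplements

/-!
# PercRepro — THE COLOOP COUNT OF A DEPENDENT SET, AND THE TOOLS OF THE COLOOP/CLOSURE LP (p2, gen 29;
SUBCLAIM-S1 §6.10 (xviii))

In a simple matroid (all pairs of rank `2`) a dependent set `S` has at most `ρ(S) − 2` «coloops» — elements `x ∈ S`
with `ρ(S ∖ x) < ρ(S)`: removing them all lowers the rank by their number and leaves a dependent set, which contains a
circuit of at least two elements and so has rank at least `2`. Under «lines have at most `3` points» a set of nullity
at least `2` has at most `ρ(S) − 3` of them. These are the fibre bounds of the incidences «a `k`-set of rank `b` inside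
a `(k + 1)`-set» that close the small cells of the `q = 4` window for EVERY simple coloop-free matroid (connected or
not). Also here: the extension bound of a rank-`b` set in a coloop-free matroid (its closure has at most
`n − (p − b + 1)` points), the complement bijection of set families, and the `Y`-sum over the rank classes by size.
Nothing is claimed about any cell.

* `eRk_sdiff_add_encard_of_forall_notMem_closure`, **`ncard_coloops_add_two_le_eRk`**,
  `ncard_coloops_add_three_le_eRk_of_lines`, `ncard_extensions_le_of_coloops`, `ncard_setOf_compl_eq`,
  `sum_ncard_rkSets_le_ncard_rankSet`.
Axioms: standard.
-/

open scoped Matroid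

namespace PercRepro

namespace S1

open Set

variable {α : Type}

section Coloops

variable {M : Matroid α} [M.Finite]

omit [M.Finite] in
/-- Removing a finite set `C ⊆ S` of elements each outside the closure of the rest of `S` lowers the rank by `|C|`. -/
theorem eRk_sdiff_add_encard_of_forall_notMem_closure {S C : Set α} (hCS : C ⊆ S) (hCfin : C.Finite)
    (h : ∀ x ∈ C, x ∈ M.E ∧ x ∉ M.closure (S \ {x})) : M.eRk (S \ C) + C.encard = M.eRk S := by
  induction C, hCfin using Set.Finite.induction_on with
  | empty => simp
  | @insert a C' haC' hC'fin ih =>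
    have hC'S : C' ⊆ S := (subset_insert a C').trans hCS
    have haS : a ∈ S := hCS (mem_insert a C')
    have ha := h a (mem_insert a C')
    have ih' := ih hC'S (fun x hx => h x (mem_insert_of_mem a hx))
    -- `S \ C' = insert a ((S \ C') \ {a})` and `a ∉ cl((S \ C') \ {a})`
    have hsub : (S \ C') \ {a} ⊆ S \ {a} := sdiff_subset_sdiff_left sdiff_subset
    have hnot : a ∉ M.closure ((S \ C') \ {a}) := fun hmem => ha.2 (M.closure_subset_closure hsub hmem)
    have hins : insert a ((S \ C') \ {a}) = S \ C' := by
      ext y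
      simp only [mem_insert_iff, mem_sdiff, mem_singleton_iff]
      constructor
      · rintro (rfl | ⟨⟨hyS, hyC'⟩, -⟩)
        · exact ⟨haS, haC'⟩
        · exact ⟨hyS, hyC'⟩
      · rintro ⟨hyS, hyC'⟩
        by_cases hya : y = a
        · exact Or.inl hya
        · exact Or.inr ⟨⟨hyS, hyC'⟩, hya⟩
    have hstep : M.eRk (S \ C') = M.eRk ((S \ C') \ {a}) + 1 := by
      rw [← hins, M.eRk_insert_eq_add_one ⟨ha.1, hnot⟩]
      rw [hins]
    have hdiff : S \ insert a C' = (S \ C') \ {a} := by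
      ext y
      simp only [mem_sdiff, mem_insert_iff, mem_singleton_iff]
      tauto
    rw [hdiff, encard_insert_of_notMem haC', ← ih', hstep]
    ring

/-- **THE COLOOP COUNT OF A DEPENDENT SET**: in a matroid with all pairs of rank `2` (and at least two points), a
dependent set `S` of rank `r` has at most `r − 2` elements `x` with `ρ(S ∖ x) + 1 = ρ(S)`. -/
theorem ncard_coloops_add_two_le_eRk (hpairs : ∀ e ∈ M.E, ∀ f ∈ M.E, e ≠ f → M.eRk {e, f} = 2)
    (hE2 : 2 ≤ M.E.ncard) {S : Set α} (hS : S ⊆ M.E) {r : ℕ} (hr : M.eRk S = (r : ℕ∞))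
    (hdep : r + 1 ≤ S.ncard) : {x ∈ S | M.eRk (S \ {x}) + 1 = M.eRk S}.ncard + 2 ≤ r := by
  set C := {x ∈ S | M.eRk (S \ {x}) + 1 = M.eRk S} with hCdef
  have hSfin : S.Finite := M.ground_finite.subset hS
  have hCS : C ⊆ S := fun x hx => hx.1
  have hCfin : C.Finite := hSfin.subset hCS
  -- each element of `C` lies outside the closure of the rest
  have hout : ∀ x ∈ C, x ∈ M.E ∧ x ∉ M.closure (S \ {x}) := by
    intro x hx
    refine ⟨hS hx.1, fun hmem => ?_⟩
    have hsub : S ⊆ M.closure (S \ {x}) := by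
      intro y hy
      by_cases hyx : y = x
      · rw [hyx]; exact hmem
      · exact M.subset_closure (S \ {x}) (sdiff_subset.trans hS) ⟨hy, hyx⟩
    have h1 : M.eRk S ≤ M.eRk (S \ {x}) := by
      calc M.eRk S ≤ M.eRk (M.closure (S \ {x})) := M.eRk_mono hsub
        _ = M.eRk (S \ {x}) := M.eRk_closure_eq _
    have h2 := hx.2
    have hle : M.eRk (S \ {x}) ≤ (r : ℕ∞) := by rw [← hr]; exact M.eRk_mono sdiff_subset
    have hfin : M.eRk (S \ {x}) ≠ ⊤ := ne_top_of_le_ne_top (ENat.coe_ne_top r) hle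
    obtain ⟨a, ha⟩ := ENat.ne_top_iff_exists.mp hfin
    rw [← ha] at h1 h2
    rw [← h2] at h1
    have : a + 1 ≤ a := by exact_mod_cast h1
    omega
  have hA := eRk_sdiff_add_encard_of_forall_notMem_closure (M := M) hCS hCfin hout
  rw [hr] at hA
  -- `S ∖ C` is dependent: its rank is below its size
  have hsize : (S \ C).encard + C.encard = S.encard := encard_sdiff_add_encard_of_subset hCS
  have hfinD : M.eRk (S \ C) ≠ ⊤ := ne_top_of_le_ne_top (ENat.coe_ne_top r) (by rw [← hA]; exact le_self_add)
  obtain ⟨a, ha⟩ := ENat.ne_top_iff_exists.mp hfinD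
  rw [← ha] at hA
  rw [← hCfin.cast_ncard_eq] at hA hsize
  rw [← hSfin.cast_ncard_eq, ← (hSfin.subset sdiff_subset).cast_ncard_eq] at hsize
  have hA' : a + C.ncard = r := by exact_mod_cast hA
  have hsize' : (S \ C).ncard + C.ncard = S.ncard := by exact_mod_cast hsize
  have hlt : M.eRk (S \ C) < (S \ C).encard := by
    rw [← ha, ← (hSfin.subset sdiff_subset).cast_ncard_eq]
    exact_mod_cast (show a < (S \ C).ncard by omega)
  have hdepD : M.Dep (S \ C) :=
    (M.eRk_lt_encard_iff_dep_of_finite (hSfin.subset sdiff_subset) (sdiff_subset.trans hS)).mp hlt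
  obtain ⟨K, hKsub, hK⟩ := hdepD.exists_isCircuit_subset
  -- the circuit has two distinct elements (no loops, no parallel pairs)
  have hK2 : 1 < K.encard := by
    by_contra hle
    push Not at hle
    obtain ⟨e, hKe⟩ := encard_eq_one.mp (le_antisymm hle (by
      have := hK.nonempty
      exact Order.one_le_iff_pos.mpr (encard_pos.mpr this)))
    have heE : e ∈ M.E := hK.subset_ground (hKe ▸ mem_singleton e)
    have hloop : M.eRk {e} = 0 := by
      have h1 := hK.eRk_add_one_eq
      rw [hKe, encard_singleton] at h1
      have hfin : M.eRk {e} ≠ ⊤ := ne_top_of_le_ne_top (by decide) (M.eRk_singleton_le e)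
      obtain ⟨n, hn⟩ := ENat.ne_top_iff_exists.mp hfin
      rw [← hn] at h1 ⊢
      have h2 : n + 1 = 1 := by exact_mod_cast h1
      have h3 : n = 0 := by omega
      rw [h3]; rfl
    obtain ⟨f, hfE, hfe⟩ := exists_ne_of_one_lt_ncard (by omega : 1 < M.E.ncard) e
    have hpair := hpairs e heE f hfE (Ne.symm hfe)
    have hle2 : M.eRk {e, f} ≤ M.eRk {e} + M.eRk {f} := by
      have := M.eRk_union_le_eRk_add_eRk {e} {f}
      rwa [singleton_union] at this
    rw [hpair, hloop, zero_add] at hle2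
    have := M.eRk_singleton_le f
    have h3 : (2 : ℕ∞) ≤ 1 := hle2.trans this
    exact absurd h3 (by decide)
  obtain ⟨e, f, heK, hfK, hef⟩ := one_lt_encard_iff.mp hK2
  have hKE : K ⊆ M.E := hK.subset_ground
  have hpair := hpairs e (hKE heK) f (hKE hfK) hef
  have h2 : (2 : ℕ∞) ≤ M.eRk (S \ C) := by
    calc (2 : ℕ∞) = M.eRk {e, f} := hpair.symm
      _ ≤ M.eRk K := M.eRk_mono (by
          intro y hy
          rcases hy with rfl | rfl
          · exact heK
          · exact hfK)
      _ ≤ M.eRk (S \ C) := M.eRk_mono hKsub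
  rw [← ha] at h2
  have h2' : 2 ≤ a := by exact_mod_cast h2
  omega

/-- **THE COLOOP COUNT UNDER «LINES HAVE AT MOST `3` POINTS»**: a set of nullity at least `2` has at most `r − 3` of them
(what is left after removing them has nullity `≥ 2`, hence at least `4` points, hence rank `≥ 3`). -/
theorem ncard_coloops_add_three_le_eRk_of_lines (hpairs : ∀ e ∈ M.E, ∀ f ∈ M.E, e ≠ f → M.eRk {e, f} = 2)
    (hlines : ∀ L ⊆ M.E, M.eRk L = 2 → L.ncard ≤ 3)
    (hE2 : 2 ≤ M.E.ncard) {S : Set α} (hS : S ⊆ M.E) {r : ℕ} (hr : M.eRk S = (r : ℕ∞))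
    (hdep : r + 2 ≤ S.ncard) : {x ∈ S | M.eRk (S \ {x}) + 1 = M.eRk S}.ncard + 3 ≤ r := by
  set C := {x ∈ S | M.eRk (S \ {x}) + 1 = M.eRk S} with hCdef
  have hSfin : S.Finite := M.ground_finite.subset hS
  have hCS : C ⊆ S := fun x hx => hx.1
  have hCfin : C.Finite := hSfin.subset hCS
  have hout : ∀ x ∈ C, x ∈ M.E ∧ x ∉ M.closure (S \ {x}) := by
    intro x hx
    refine ⟨hS hx.1, fun hmem => ?_⟩
    have hsub : S ⊆ M.closure (S \ {x}) := by
      intro y hy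
      by_cases hyx : y = x
      · rw [hyx]; exact hmem
      · exact M.subset_closure (S \ {x}) (sdiff_subset.trans hS) ⟨hy, hyx⟩
    have h1 : M.eRk S ≤ M.eRk (S \ {x}) := by
      calc M.eRk S ≤ M.eRk (M.closure (S \ {x})) := M.eRk_mono hsub
        _ = M.eRk (S \ {x}) := M.eRk_closure_eq _
    have h2 := hx.2
    have hle : M.eRk (S \ {x}) ≤ (r : ℕ∞) := by rw [← hr]; exact M.eRk_mono sdiff_subset
    have hfin : M.eRk (S \ {x}) ≠ ⊤ := ne_top_of_le_ne_top (ENat.coe_ne_top r) hle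
    obtain ⟨a, ha⟩ := ENat.ne_top_iff_exists.mp hfin
    rw [← ha] at h1 h2
    rw [← h2] at h1
    have : a + 1 ≤ a := by exact_mod_cast h1
    omega
  have hA := eRk_sdiff_add_encard_of_forall_notMem_closure (M := M) hCS hCfin hout
  rw [hr] at hA
  have hsize : (S \ C).encard + C.encard = S.encard := encard_sdiff_add_encard_of_subset hCS
  have hfinD : M.eRk (S \ C) ≠ ⊤ := ne_top_of_le_ne_top (ENat.coe_ne_top r) (by rw [← hA]; exact le_self_add)
  obtain ⟨a, ha⟩ := ENat.ne_top_iff_exists.mp hfinD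
  rw [← ha] at hA
  rw [← hCfin.cast_ncard_eq] at hA hsize
  rw [← hSfin.cast_ncard_eq, ← (hSfin.subset sdiff_subset).cast_ncard_eq] at hsize
  have hA' : a + C.ncard = r := by exact_mod_cast hA
  have hsize' : (S \ C).ncard + C.ncard = S.ncard := by exact_mod_cast hsize
  -- the two-point lower bound from the simple case
  have h2 := ncard_coloops_add_two_le_eRk hpairs hE2 hS hr (by omega)
  rw [← hCdef] at h2
  -- rank `2` would make `S ∖ C` a set of rank `2` with at least `4` points
  by_contra hlt
  push Not at hlt
  have ha2 : a = 2 := by omega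
  have hL := hlines (S \ C) (sdiff_subset.trans hS) (by rw [← ha, ha2]; rfl)
  omega

omit [M.Finite] in
/-- The `k`-subsets of rank `b` of a `(k + 1)`-set of rank `b + 1` are the complements of its coloops. -/
theorem setOf_eRk_sdiff_eq_of_eRk_succ {S : Set α} {b : ℕ} (hSb : M.eRk S = ((b + 1 : ℕ) : ℕ∞)) :
    {x ∈ S | M.eRk (S \ {x}) = (b : ℕ∞)} = {x ∈ S | M.eRk (S \ {x}) + 1 = M.eRk S} := by
  ext x
  simp only [mem_setOf_eq]
  constructor
  · rintro ⟨hxS, hx⟩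
    refine ⟨hxS, ?_⟩
    rw [hx, hSb]
    push_cast
    rfl
  · rintro ⟨hxS, hx⟩
    refine ⟨hxS, ?_⟩
    have hle : M.eRk (S \ {x}) ≤ ((b + 1 : ℕ) : ℕ∞) := by rw [← hSb]; exact M.eRk_mono sdiff_subset
    have hfin : M.eRk (S \ {x}) ≠ ⊤ := ne_top_of_le_ne_top (ENat.coe_ne_top _) hle
    obtain ⟨a, ha⟩ := ENat.ne_top_iff_exists.mp hfin
    rw [← ha, hSb] at hx
    rw [← ha]
    have : a + 1 = b + 1 := by exact_mod_cast hx
    have : a = b := by omega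
    rw [this]

/-- A `(k + 1)`-set `S` of rank `b` has at least `(k + 1) − #coloops(S)` subsets `S ∖ x` of rank `b`. -/
theorem ncard_le_ncard_setOf_eRk_sdiff_eq {S : Set α} (hS : S ⊆ M.E) {b : ℕ} (hSb : M.eRk S = (b : ℕ∞)) :
    S.ncard ≤ {x ∈ S | M.eRk (S \ {x}) = (b : ℕ∞)}.ncard + {x ∈ S | M.eRk (S \ {x}) + 1 = M.eRk S}.ncard := by
  have hSfin : S.Finite := M.ground_finite.subset hS
  have hsub : S ⊆ {x ∈ S | M.eRk (S \ {x}) = (b : ℕ∞)} ∪ {x ∈ S | M.eRk (S \ {x}) + 1 = M.eRk S} := by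
    intro x hxS
    simp only [mem_union, mem_setOf_eq]
    have hle : M.eRk (S \ {x}) ≤ (b : ℕ∞) := by rw [← hSb]; exact M.eRk_mono sdiff_subset
    have hfin : M.eRk (S \ {x}) ≠ ⊤ := ne_top_of_le_ne_top (ENat.coe_ne_top _) hle
    obtain ⟨a, ha⟩ := ENat.ne_top_iff_exists.mp hfin
    have hge : M.eRk S ≤ M.eRk (S \ {x}) + 1 := by
      have hins : insert x (S \ {x}) = S := insert_sdiff_singleton.trans (insert_eq_of_mem hxS)
      have := M.eRk_insert_le_add_one x (S \ {x})
      rwa [hins] at this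
    rw [← ha] at hle hge ⊢
    rw [hSb] at hge ⊢
    have hle' : a ≤ b := by exact_mod_cast hle
    have hge' : b ≤ a + 1 := by exact_mod_cast hge
    rcases Nat.lt_or_ge a b with hlt | hge2
    · right
      refine ⟨hxS, ?_⟩
      have : a + 1 = b := by omega
      exact_mod_cast this
    · left
      refine ⟨hxS, ?_⟩
      have : a = b := by omega
      exact_mod_cast this
  exact (ncard_le_ncard hsub ((hSfin.subset (fun _ h => h.1)).union (hSfin.subset (fun _ h => h.1)))).trans
    (ncard_union_le _ _)

end Coloops

section Extensions

variable {M : Matroid α} [M.Finite]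

/-- **THE EXTENSION BOUND OF A COLOOP-FREE MATROID**: a set `B` of rank `b < p` has at most
`n − (p − b + 1) − |B|` extensions `B ∪ {x}` of the same rank (they all lie in its closure, a flat missing
at least `p − b + 1` points). -/
theorem ncard_extensions_add_le_of_coloops {p : ℕ} (hM : M.eRank = (p : ℕ∞)) (hcol : M.coloops = ∅)
    {B : Set α} (hB : B ⊆ M.E) {b : ℕ} (hb : M.eRk B = (b : ℕ∞)) (hbp : b < p) :
    {x ∈ M.E \ B | M.eRk (insert x B) = (b : ℕ∞)}.ncard + B.ncard + (p - b + 1) ≤ M.E.ncard := by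
  set T := {x ∈ M.E \ B | M.eRk (insert x B) = (b : ℕ∞)} with hTdef
  have hTE : T ⊆ M.E := fun x hx => hx.1.1
  have hXE : B ∪ T ⊆ M.E := union_subset hB hTE
  have hdisj : Disjoint B T := by
    rw [Set.disjoint_left]
    intro x hxB hxT
    exact hxT.1.2 hxB
  -- every extension of the same rank lies in the closure of `B`
  have hsubcl : B ∪ T ⊆ M.closure B := by
    intro x hx
    rcases hx with hxB | hxT
    · exact M.subset_closure B hB hxB
    · by_contra hnot
      have h := M.eRk_insert_eq_add_one ⟨hxT.1.1, hnot⟩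
      rw [hxT.2, hb] at h
      have h' : b = b + 1 := by exact_mod_cast h
      omega
  have hrk : M.eRk (B ∪ T) = (b : ℕ∞) := by
    apply le_antisymm
    · calc M.eRk (B ∪ T) ≤ M.eRk (M.closure B) := M.eRk_mono hsubcl
        _ = (b : ℕ∞) := by rw [M.eRk_closure_eq, hb]
    · rw [← hb]; exact M.eRk_mono subset_union_left
  have hmiss := sub_add_one_le_ncard_ground_sdiff_of_coloops M hM hcol hXE hrk hbp
  rw [ncard_sdiff' hXE M.ground_finite, ncard_union_eq hdisj (M.ground_finite.subset hB) (M.ground_finite.subset hTE)]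
    at hmiss
  have := ncard_le_ncard hXE M.ground_finite
  rw [ncard_union_eq hdisj (M.ground_finite.subset hB) (M.ground_finite.subset hTE)] at this
  omega

end Extensions

section Complements

/-- **THE COMPLEMENT BIJECTION**: the families `{A ⊆ E : P A}` and `{B ⊆ E : P (E ∖ B)}` have the same size. -/
theorem ncard_setOf_compl_eq (E : Set α) (P : Set α → Prop) :
    {B : Set α | B ⊆ E ∧ P (E \ B)}.ncard = {A : Set α | A ⊆ E ∧ P A}.ncard := by
  have himg : (fun B : Set α => E \ B) '' {B : Set α | B ⊆ E ∧ P (E \ B)} = {A : Set α | A ⊆ E ∧ P A} := by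
    ext A
    simp only [mem_image, mem_setOf_eq]
    constructor
    · rintro ⟨B, ⟨hBE, hPB⟩, rfl⟩
      exact ⟨sdiff_subset, hPB⟩
    · rintro ⟨hAE, hPA⟩
      refine ⟨E \ A, ⟨sdiff_subset, ?_⟩, sdiff_sdiff_cancel_left hAE⟩
      rw [sdiff_sdiff_cancel_left hAE]
      exact hPA
  rw [← himg, InjOn.ncard_image]
  intro B hB B' hB' hBB'
  have h : E \ B = E \ B' := hBB'
  rw [← sdiff_sdiff_cancel_left hB.1, ← sdiff_sdiff_cancel_left hB'.1, h]

end Complements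

section YSum

variable {M : Matroid α} [M.Finite]

/-- **THE `Y`-SUM**: the rank classes by size of one rank level are disjoint subsets of that level. -/
theorem sum_ncard_rkSets_le_ncard_rankSet (r : ℕ) (K : Finset ℕ) :
    ∑ k ∈ K, (rkSets M k r).ncard ≤ (rankSet M r).ncard := by
  have hsub : (⋃ k ∈ (K : Set ℕ), rkSets M k r) ⊆ rankSet M r := by
    intro A hA
    rw [mem_iUnion₂] at hA
    obtain ⟨k, -, hAk⟩ := hA
    exact ⟨hAk.1, hAk.2.2⟩
  have hdisj : (K : Set ℕ).PairwiseDisjoint (fun k => rkSets M k r) := by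
    intro k _ k' _ hkk'
    rw [Function.onFun, Set.disjoint_left]
    rintro A ⟨-, hAk, -⟩ ⟨-, hAk', -⟩
    exact hkk' (hAk.symm.trans hAk')
  have heq := (K.finite_toSet).ncard_biUnion (s := fun k => rkSets M k r) (fun k _ => rkSets_finite k r) hdisj
  rw [finsum_mem_coe_finset] at heq
  rw [← heq]
  exact ncard_le_ncard hsub (M.ground_finite.finite_subsets.subset (fun _ hA => hA.1))

end YSum

end S1

end PercRepro
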